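import Mathlib.Probability.Independence.Integration
import Literature.Probability.Percolation.BernoulliPercolation
import Literature.Probability.Percolation.PercolationEvents
import HarnessLib

/-!
# Bond percolation: coordinate σ-algebras, local functions and the product formula

Crux `Summit.CriticalPhenomena.CardyFormulaZ2.Theses.CardyMagicRigidity.NestingRigidity`
(stmt-CriticalPhenomena-4835), line `markov-cascade-one-generation`, helper toward stub
`stub_oneGenerationZ2 : OneGenerationZ2` (S1): the probabilistic half of the one-generation
factorisation (the domain-Markov property of the product measure `P_p = bondPercolation G p`).

For a set of edges `S ⊆ Sym2 V` let `𝓕[S] = ⨆ e ∈ S, σ(ω ↦ e ∈ ω)` be the σ-algebra of the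
coordinates in `S` (always written out in full below; no definition or notation is introduced).
We prove:

* `measurable_inter_coord` — the restriction `ω ↦ ω ∩ S` is `𝓕[S]`-measurable, hence every
  measurable event determined by the coordinates in `S` is `𝓕[S]`-measurable
  (`measurableSet_coord_of_determinedBy`), and every function determined by FINITELY many
  coordinates is `𝓕[S]`-measurable outright (`measurable_coord_of_determined_finite`: it factors
  through the finite type `S → Prop`);
* `indep_coord` — for disjoint `S`, `T` the σ-algebras `𝓕[S]`, `𝓕[T]` are independent under `P_p`
  (Mathlib's `indep_iSup_of_disjoint` on the independent coordinates
  `bondPercolation_iIndepFun_mem`);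
* the product formulas `measure_inter_eq_mul_of_coord` (events) and
  `bondPercolation_integral_mul_indicator` (registered helper: `E[g · 1_B] = E[g] · P(B)` for `g`
  determined by finitely many coordinates off the coordinates determining `B`).
-/

noncomputable section

open MeasureTheory ProbabilityTheory Set Function
open scoped ENNReal

namespace Summit.CriticalPhenomena.CardyFormulaZ2.Cruxes.NestingRigidity.MarkovCascadeOneGeneration

open Literature.Probability.Percolation

variable {V : Type*}

/-! ## Coordinate σ-algebras and local functions -/

/-- The coordinate σ-algebra `𝓕[S] := ⨆ e ∈ S, σ(ω ↦ e ∈ ω)` (always written out) is a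
sub-σ-algebra of the product σ-algebra on `BondConfig V`. -/
theorem coord_le (S : Set (Sym2 V)) :
    (⨆ e ∈ S, MeasurableSpace.comap (fun ω : BondConfig V ↦ e ∈ ω) inferInstance) ≤
      (inferInstance : MeasurableSpace (BondConfig V)) :=
  iSup₂_le fun e _ ↦ (measurable_set_mem e).comap_le

/-- A coordinate in `S` is `𝓕[S]`-measurable. -/
theorem measurable_mem_coord {S : Set (Sym2 V)} {e : Sym2 V} (he : e ∈ S) :
    Measurable[⨆ e ∈ S, MeasurableSpace.comap (fun ω : BondConfig V ↦ e ∈ ω) inferInstance]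
      fun ω : BondConfig V ↦ e ∈ ω :=
  Measurable.of_comap_le (le_iSup₂ (f := fun e (_ : e ∈ S) ↦
    MeasurableSpace.comap (fun ω : BondConfig V ↦ e ∈ ω) inferInstance) e he)

/-- **The restriction `ω ↦ ω ∩ S` is `𝓕[S]`-measurable** (into the product σ-algebra). -/
theorem measurable_inter_coord (S : Set (Sym2 V)) :
    Measurable[⨆ e ∈ S, MeasurableSpace.comap (fun ω : BondConfig V ↦ e ∈ ω) inferInstance]
      fun ω : BondConfig V ↦ ω ∩ S := by
  refine @measurable_set_iff (Sym2 V) (BondConfig V)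
    (⨆ e ∈ S, MeasurableSpace.comap (fun ω : BondConfig V ↦ e ∈ ω) inferInstance) _ |>.2
    fun a ↦ ?_
  by_cases ha : a ∈ S
  · have : (fun ω : BondConfig V ↦ a ∈ ω ∩ S) = fun ω ↦ a ∈ ω :=
      funext fun ω ↦ propext ⟨fun h ↦ h.1, fun h ↦ ⟨h, ha⟩⟩
    rw [this]
    exact measurable_mem_coord ha
  · have : (fun ω : BondConfig V ↦ a ∈ ω ∩ S) = fun _ ↦ False :=
      funext fun ω ↦ propext ⟨fun h ↦ ha h.2, False.elim⟩
    rw [this]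
    exact measurable_const

/-- A measurable event determined by the coordinates in `S` is `𝓕[S]`-measurable. -/
theorem measurableSet_coord_of_determinedBy {A : Set (BondConfig V)} {S : Set (Sym2 V)}
    (hA : DeterminedBy A S) (hm : MeasurableSet A) :
    MeasurableSet[⨆ e ∈ S, MeasurableSpace.comap (fun ω : BondConfig V ↦ e ∈ ω) inferInstance]
      A := by
  have hpre : (fun ω : BondConfig V ↦ ω ∩ S) ⁻¹' A = A := by
    ext ω
    exact (determinedBy_iff A S).1 hA _ _ (by rw [inter_assoc, inter_self])
  rw [← hpre]
  exact hm.preimage (measurable_inter_coord S)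

/-- **A function determined by finitely many coordinates is `𝓕[S]`-measurable** (it factors
through the finite measurable space `S → Prop`, on which every function is measurable). -/
theorem measurable_coord_of_determined_finite {β : Type*} [MeasurableSpace β]
    {g : BondConfig V → β} {S : Set (Sym2 V)} (hS : S.Finite)
    (hg : ∀ ω ω' : BondConfig V, ω ∩ S = ω' ∩ S → g ω = g ω') :
    Measurable[⨆ e ∈ S, MeasurableSpace.comap (fun ω : BondConfig V ↦ e ∈ ω) inferInstance]
      g := by
  haveI : Finite S := hS.to_subtype
  let r : BondConfig V → (S → Prop) := fun ω e ↦ (e : Sym2 V) ∈ ω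
  let L : (S → Prop) → BondConfig V := fun y ↦ {e | ∃ h : e ∈ S, y ⟨e, h⟩}
  have hr : Measurable[⨆ e ∈ S, MeasurableSpace.comap (fun ω : BondConfig V ↦ e ∈ ω)
      inferInstance] r :=
    @measurable_pi_iff (BondConfig V) S (fun _ ↦ Prop)
      (⨆ e ∈ S, MeasurableSpace.comap (fun ω : BondConfig V ↦ e ∈ ω) inferInstance) _ r |>.2
      fun e ↦ measurable_mem_coord e.2
  have hfac : (g ∘ L) ∘ r = g := by
    funext ω
    refine hg _ _ (Set.ext fun e ↦ ⟨?_, ?_⟩)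
    · rintro ⟨⟨_, he⟩, heS⟩
      exact ⟨he, heS⟩
    · rintro ⟨he, heS⟩
      exact ⟨⟨heS, he⟩, heS⟩
  rw [← hfac]
  exact (measurable_of_countable (g ∘ L)).comp hr

/-! ## Independence of disjoint families of coordinates under `P_p` -/

/-- **Disjoint families of coordinates are independent under bond percolation** (product
measure). -/
theorem indep_coord [Countable V] (G : SimpleGraph V) (p : unitInterval) {S T : Set (Sym2 V)}
    (hST : Disjoint S T) :
    Indep (⨆ e ∈ S, MeasurableSpace.comap (fun ω : BondConfig V ↦ e ∈ ω) inferInstance)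
      (⨆ e ∈ T, MeasurableSpace.comap (fun ω : BondConfig V ↦ e ∈ ω) inferInstance)
      (bondPercolation G p) := by
  have h := bondPercolation_iIndepFun_mem G p
  rw [iIndepFun_iff_iIndep] at h
  exact indep_iSup_of_disjoint (fun e ↦ (measurable_set_mem e).comap_le) h hST

/-- Product formula for events of disjoint families of coordinates. -/
theorem measure_inter_eq_mul_of_coord [Countable V] (G : SimpleGraph V) (p : unitInterval)
    {S T : Set (Sym2 V)} (hST : Disjoint S T) {A B : Set (BondConfig V)}
    (hA : MeasurableSet[⨆ e ∈ S, MeasurableSpace.comap (fun ω : BondConfig V ↦ e ∈ ω)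
      inferInstance] A)
    (hB : MeasurableSet[⨆ e ∈ T, MeasurableSpace.comap (fun ω : BondConfig V ↦ e ∈ ω)
      inferInstance] B) :
    bondPercolation G p (A ∩ B) = bondPercolation G p A * bondPercolation G p B :=
  (Indep_iff _ _ _).1 (indep_coord G p hST) A B hA hB

/-- Product formula `E[g · 1_B] = E[g] · P(B)` for an `𝓕[S]`-measurable real `g` and an
`𝓕[T]`-measurable event `B`, `S ∩ T = ∅`. -/
theorem integral_mul_indicator_of_coord [Countable V] (G : SimpleGraph V) (p : unitInterval)
    {S T : Set (Sym2 V)} (hST : Disjoint S T) {g : BondConfig V → ℝ}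
    (hg : Measurable[⨆ e ∈ S, MeasurableSpace.comap (fun ω : BondConfig V ↦ e ∈ ω)
      inferInstance] g)
    {B : Set (BondConfig V)}
    (hB : MeasurableSet[⨆ e ∈ T, MeasurableSpace.comap (fun ω : BondConfig V ↦ e ∈ ω)
      inferInstance] B) :
    ∫ ω, g ω * B.indicator 1 ω ∂(bondPercolation G p) =
      (∫ ω, g ω ∂(bondPercolation G p)) * (bondPercolation G p).real B := by
  have hBm : MeasurableSet B := coord_le T _ hB
  have hind : IndepFun g (B.indicator (1 : BondConfig V → ℝ)) (bondPercolation G p) := by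
    rw [IndepFun_iff_Indep]
    refine indep_of_indep_of_le_right (indep_of_indep_of_le_left (indep_coord G p hST)
      hg.comap_le) (Measurable.comap_le ?_)
    have h1 : Measurable[⨆ e ∈ T, MeasurableSpace.comap (fun ω : BondConfig V ↦ e ∈ ω)
        inferInstance] fun _ : BondConfig V ↦ (1 : ℝ) := measurable_const
    exact h1.indicator hB
  rw [hind.integral_fun_mul_eq_mul_integral (hg.mono (coord_le S) le_rfl).aestronglyMeasurable
    ((measurable_const.indicator hBm).aestronglyMeasurable), integral_indicator_one hBm]

/-- **Product formula for local functions** (registered helper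
`bondPercolation_integral_mul_indicator` toward `stub_oneGenerationZ2`): if the real function `g`
is determined by the coordinates in a finite set `S` of edges and the measurable event `B` by the
coordinates in a set `T` disjoint from `S`, then `E[g · 1_B] = E[g] · P(B)` under
`bondPercolation G p`. -/
theorem bondPercolation_integral_mul_indicator : ∀ {V : Type*} [Countable V] (G : SimpleGraph V)
    (p : unitInterval) (S T : Set (Sym2 V)) (g : BondConfig V → ℝ) (B : Set (BondConfig V)),
    S.Finite → Disjoint S T → (∀ ω ω' : BondConfig V, ω ∩ S = ω' ∩ S → g ω = g ω') →
    DeterminedBy B T → MeasurableSet B →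
    ∫ ω, g ω * B.indicator 1 ω ∂(bondPercolation G p) =
      (∫ ω, g ω ∂(bondPercolation G p)) * (bondPercolation G p).real B :=
  fun G p _ _ _ _ hS hST hg hBT hBm ↦ integral_mul_indicator_of_coord G p hST
    (measurable_coord_of_determined_finite hS hg) (measurableSet_coord_of_determinedBy hBT hBm)

/-- Product formula for a local event and an event of the complementary coordinates:
`P(A ∩ B) = P(A) P(B)`. -/
theorem bondPercolation_inter_of_determinedBy [Countable V] (G : SimpleGraph V) (p : unitInterval)
    {S T : Set (Sym2 V)} (hS : S.Finite) (hST : Disjoint S T) {A B : Set (BondConfig V)}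
    (hA : DeterminedBy A S) (hBT : DeterminedBy B T) (hBm : MeasurableSet B) :
    bondPercolation G p (A ∩ B) = bondPercolation G p A * bondPercolation G p B := by
  classical
  refine measure_inter_eq_mul_of_coord G p hST ?_ (measurableSet_coord_of_determinedBy hBT hBm)
  have hind : Measurable[⨆ e ∈ S, MeasurableSpace.comap (fun ω : BondConfig V ↦ e ∈ ω)
      inferInstance] (A.indicator (1 : BondConfig V → ℝ)) := by
    refine measurable_coord_of_determined_finite hS fun ω ω' h ↦ ?_
    by_cases hω : ω ∈ A
    · rw [indicator_of_mem hω, indicator_of_mem (((determinedBy_iff A S).1 hA ω ω' h).1 hω)]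
      rfl
    · rw [indicator_of_notMem hω,
        indicator_of_notMem fun h' ↦ hω (((determinedBy_iff A S).1 hA ω ω' h).2 h')]
  have h1 : MeasurableSet[⨆ e ∈ S, MeasurableSpace.comap (fun ω : BondConfig V ↦ e ∈ ω)
      inferInstance] ((A.indicator (1 : BondConfig V → ℝ)) ⁻¹' {1}) :=
    hind (measurableSet_singleton 1)
  have hpre : (A.indicator (1 : BondConfig V → ℝ)) ⁻¹' {1} = A := by
    ext ω
    by_cases hω : ω ∈ A <;> simp [hω]
  rwa [hpre] at h1

end Summit.CriticalPhenomena.CardyFormulaZ2.Cruxes.NestingRigidity.MarkovCascadeOneGeneration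

end
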